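import Literature.Geometry.Riemannian.CuspedHyperbolic
import Literature.Geometry.Riemannian.CartanHadamard
import Mathlib.MeasureTheory.Measure.Haar.OfBasis
import Mathlib.Analysis.Normed.Module.Connected
import HarnessLib

/-!
# Dehn fillings with long slopes: the consequences of the Gromov–Thurston `2π` theorem

Topic `Literature/Geometry/Riemannian`; cite item `wi-11525` ("fact: Gromov–Thurston `2π` theorem
in dimension `n` … hence aspherical and not simply connected") for the support item
`LongFillingsNotSimplyConnected` of route `SmoothPoincare4/HyperbolicTorusFillings`.

The `2π` theorem itself is the named fact
`Literature.Geometry.Riemannian.gromovThurston_twoPi_four` of `CuspedHyperbolic.lean` (Anderson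
2006, §2.1, (2.4), verbatim: "when the length `L(σ)` of `σ` in the flat torus `(T^{n-1}, g₀)`
satisfies `L(σ) ≥ 2π`, the resulting manifold `M_σ` has a complete metric of non-positive sectional
curvature and finite volume. Although proved in the context of 3-manifolds, the same result and
proof holds in any dimension"; Ratcliffe–Tschantz 2005, §2, p. 5: "the Gromov-Thurston `2π`
theorem implies that the hyperbolic metric in the interior of `M̄` extends to a Riemannian metric
on `M̂` of nonpositive curvature when `length(mᵢ') ≥ 2π` for each `i`, in which case, `M̂` is
aspherical by Cartan's theorem").  THIS FILE PROVES what the route consumes from it, in the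
vocabulary of `CuspedHyperbolic.lean` (`TorusCusp`, `TorusCuspSystem`, `IsDehnFilling`,
`slopeLength`):

* `IsDehnFilling.compactSpace` — a Dehn filling `P = X ∪ ⋃ᵢ (T² × D̊²)` of ALL the cusps of a
  cusp system with compact exterior is a compact (closed) manifold (Anderson 2006, §2.1: the Dehn
  filled manifold `M_σ̄`; Ratcliffe–Tschantz 2005, §2, p. 4: "the closed 4-manifold `M̂` obtained
  by Dehn filling").  Proof: `P` is the union of the three compact sets `jA (exterior)`,
  `jA (cusp collars {0 ≤ t ≤ 1})` and `jB (T² × {‖w‖ ≤ e⁻¹})`, the gluing relation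
  `IsDehnFilling`/`TorusCusp.fillingRel` identifying the cusp point `C (x, t)`, `t > 0`, with a
  point of the piece at radius `e^{-t}`.
* `IsDehnFilling.connectedSpace` — it is connected when `X` is.
* `IsDehnFilling.not_simplyConnectedSpace_of_two_pi_le` — **"fake 4-spheres are exceptional
  fillings"**: modulo the two named facts `gromovThurston_twoPi_four` (Anderson 2006, (2.4)) and
  `Lee2018_not_simplyConnected_of_nonpos_curvature` (Lee 2018, Cor. 12.11), a Dehn filling of a
  complete finite-volume hyperbolic `4`-manifold with `3`-torus cusps all of whose slopes have
  flat length `≥ 2π` is not simply connected (Ratcliffe–Tschantz 2005, §5, p. 9: "`M̂` admits a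
  Riemannian metric of nonpositive curvature. This implies that the universal cover of `M̂` is
  diffeomorphic to `ℝ⁴` by Cartan's theorem; in which case `M̂` is aspherical").
* `IsDehnFilling.exists_covering_of_two_pi_le` — the asphericity clause in the tree's form:
  modulo `gromovThurston_twoPi_four` and `Lee2018_cartanHadamard_compact` (Lee 2018, Thm. 12.8),
  such a filling is covered by `ℝ⁴` (a covering map `ℝ⁴ → P` which is a local diffeomorphism).
* `IsDehnFilling.exists_slopeLength_lt_two_pi_of_simplyConnected` — the **census principle**
  (Ratcliffe–Tschantz 2005, §2, p. 5): a simply connected filling has a slope of flat length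
  `< 2π` on some cusp torus; with `TorusCusp.finite_setOf_slopeLength_lt_two_pi` (only finitely
  many filling coefficients per cusp are that short) this is the finiteness statement the route
  uses.

## On the sources and the constant `2π`

The sources WITH PROOFS use the STRICT inequality.  Fujiwara–Manning 2010 (§1: "the `2π`
theorem states that 'most' Dehn fillings of a hyperbolic 3-manifold with cusps admit negatively
curved metrics", attributed to Bleiler–Hodgson 1996 [BlHo]) define in Def. 2.5: "If no `Tᵢ`
contains a geodesic of length `2π` or less, we say that `M(T₁, …, Tₘ)` is a `2π`-filling", and
prove in Thm. 2.7 that a `2π`-filling carries a complete locally `CAT(0)` path metric, "the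
completion of a path metric induced by a negatively curved Riemannian metric on the complement of
the filling cores"; their Remark 2.10 lists as special cases "the Gromov-Thurston `2π`-theorem
[BlHo], in which `n = 2` and each filling core is a circle" and "Schroeder's generalization of the
`2π` theorem to `n > 2`, with filling cores equal to `(n-1)`-dimensional tori [Sc] (… the only case
in which the filling `M(T₁, …, Tₘ)` is a manifold)" — the case of this file.  Anderson 2006, (2.4),
and Ratcliffe–Tschantz 2005 state `≥ 2π` with a non-positively curved conclusion, and the tree's
fact `gromovThurston_twoPi_four` renders exactly that printed statement.  In the tree's rendering
the two agree: a `TorusCusp` is embedded with an open margin `{t > -eps}` on which the metric is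
still the cusp model, so a cusp torus whose slope has length `L ≥ 2π` sits inside the slightly
larger embedded cusp torus `{t = -eps/2}` on which the same slope has length `e^{eps/2} L > 2π`.

## Not here

The general-dimension statement (`IsDehnFilling` is `4`-dimensional in the tree; the cusp
vocabulary `TorusCusp g m` is general) — TODO(general form): Anderson 2006, §2.1 / Schroeder 1989
(Proc. AMS 106) for fillings `D² × T^{n-2}` of toral cusps in dimension `n`; the `CAT(0)`
pseudomanifold fillings of Fujiwara–Manning 2010, Thm. 2.7; a proof of the `2π` theorem itself
(the doubly warped metric `dr² + f(r)² dθ² + h(r)² |dy|²` on the filling solid torus).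

## References

* M. T. Anderson, *Dehn filling and Einstein metrics in higher dimensions*, J. Differential Geom.
  73 (2006) 219–261, arXiv:math/0303260, §2.1, (2.2)–(2.4) (arXiv p. 5, READ). [Anderson2006]
* J. G. Ratcliffe, S. T. Tschantz, *Some examples of aspherical 4-manifolds that are homology
  4-spheres*, Topology 44 (2005) 341–350, arXiv:math/0312436, §2 (pp. 4–5), §5 (p. 9) (READ).
  [RatcliffeTschantz2005]
* K. Fujiwara, J. F. Manning, *CAT(0) and CAT(−1) fillings of hyperbolic manifolds*,
  J. Differential Geom. 85 (2010) 229–270, arXiv:0901.0056, §1, Def. 2.5, Thm. 2.7, Rem. 2.10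
  (arXiv pp. 3, 5–6, READ). [FujiwaraManning2010]
* S. A. Bleiler, C. D. Hodgson, *Spherical space forms and Dehn filling*, Topology 35 (1996)
  809–833 (the `2π` theorem in dimension `3`; cited through Fujiwara–Manning 2010, not read:
  acquisition request acq-03318). [BleilerHodgson1996]
* V. Schroeder, *A cusp closing theorem*, Proc. Amer. Math. Soc. 106 (1989) 797–802 (the manifold
  case in dimension `> 3`; cited through Fujiwara–Manning 2010, Rem. 2.10). [Schroeder1989]
* J. M. Lee, *Introduction to Riemannian Manifolds*, 2nd ed., GTM 176, Springer 2018, Thm. 12.8,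
  Cor. 12.11. [Lee2018]
-/

noncomputable section

open Bundle Set Function
open scoped Manifold ContDiff Topology

namespace Literature.Geometry.Riemannian

open Literature.Geometry.Lorentzian (PseudoRiemannianMetric)
open Literature.Geometry.Lorentzian.PseudoRiemannianMetric
open Literature.Topology.FourManifolds (circlePoint circlePoint_surjective)

section General

variable {E : Type*} [NormedAddCommGroup E] [NormedSpace ℝ E] {H : Type*} [TopologicalSpace H]
  {I : ModelWithCorners ℝ E H} {M : Type*} [TopologicalSpace M] [ChartedSpace H M]
  [IsManifold I ∞ M] {n : ℕ∞ω}
  {g : PseudoRiemannianMetric I n E (TangentSpace I : M → Type _)} {m : ℕ}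

namespace TorusCusp

/-! ### The compact collar `{0 ≤ t ≤ 1}` of a torus cusp -/

/-- The **collar domain** `Π × [0, 1] ⊂ ℝᵐ × ℝ` of a torus cusp in coordinates — the closed
parallelepiped `Π = {∑ cᵢ vᵢ | c ∈ [0, 1]ᵐ}` of the lattice basis (a fundamental domain for `Λ`
up to its boundary) times the height interval `[0, 1]` — is compact. Its image is the collar
`{0 ≤ t ≤ 1}` of the closed cusp neighbourhood. [folklore] -/
theorem isCompact_collarDomain (C : TorusCusp g m) :
    IsCompact (parallelepiped C.basis ×ˢ Icc (0 : ℝ) 1) :=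
  C.basis.parallelepiped.isCompact.prod isCompact_Icc

/-- The collar domain lies in the region `{t > -eps}` on which the cusp parametrisation is used.
[folklore] -/
theorem collarDomain_subset_region (C : TorusCusp g m) :
    parallelepiped C.basis ×ˢ Icc (0 : ℝ) 1 ⊆ {p : EuclideanSpace ℝ (Fin m) × ℝ | -C.eps < p.2} :=
  fun _ hp => lt_of_lt_of_le (neg_neg_of_pos C.eps_pos) hp.2.1

/-- The cusp parametrisation is continuous on its region. [folklore] -/
theorem continuousOn_region (C : TorusCusp g m) :
    ContinuousOn C {p : EuclideanSpace ℝ (Fin m) × ℝ | -C.eps < p.2} :=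
  C.contMDiffOn.continuousOn

/-- The collar `C (Π × [0, 1])` of a torus cusp is compact. [folklore] -/
theorem isCompact_image_collarDomain (C : TorusCusp g m) :
    IsCompact (C '' (parallelepiped C.basis ×ˢ Icc (0 : ℝ) 1)) :=
  C.isCompact_collarDomain.image_of_continuousOn
    (C.continuousOn_region.mono C.collarDomain_subset_region)

/-- Reduction modulo the lattice: `C (fract x, t) = C (x, t)`, where `fract x ∈ x + Λ` is the
representative of `x` in the fundamental domain of the basis (`ZSpan.fract`). [folklore] -/
theorem apply_fract (C : TorusCusp g m) (x : EuclideanSpace ℝ (Fin m)) {t : ℝ}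
    (ht : -C.eps < t) : C (ZSpan.fract C.basis x, t) = C (x, t) := by
  have hmem : ((ZSpan.floor C.basis x : Submodule.span ℤ (Set.range C.basis)) :
      EuclideanSpace ℝ (Fin m)) ∈ C.lattice :=
    (ZSpan.floor C.basis x).2
  have h := C.apply_add_of_mem_lattice hmem (ZSpan.fract C.basis x) ht
  have hx : ZSpan.fract C.basis x + ((ZSpan.floor C.basis x :
      Submodule.span ℤ (Set.range C.basis)) : EuclideanSpace ℝ (Fin m)) = x := by
    rw [ZSpan.fract_apply, sub_add_cancel]
  rw [hx] at h
  exact h.symm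

/-- Every point `C (x, t)` with `0 ≤ t ≤ 1` lies in the compact collar `C (Π × [0, 1])`.
[folklore] -/
theorem mem_image_collarDomain (C : TorusCusp g m) (x : EuclideanSpace ℝ (Fin m)) {t : ℝ}
    (ht0 : 0 ≤ t) (ht1 : t ≤ 1) :
    C (x, t) ∈ C '' (parallelepiped C.basis ×ˢ Icc (0 : ℝ) 1) := by
  refine ⟨(ZSpan.fract C.basis x, t), ⟨?_, ht0, ht1⟩, C.apply_fract x ?_⟩
  · exact ZSpan.fundamentalDomain_subset_parallelepiped C.basis
      (ZSpan.fract_mem_fundamentalDomain C.basis x)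
  · linarith [C.eps_pos]

/-! ### The new basis `aⱼ = ∑ₗ A_{lj} vₗ` of a unimodular `A` spans -/

/-- For a unimodular integer matrix `A` (indeed any `A` invertible over `ℝ`), the vectors
`aⱼ = ∑ₗ A_{lj} vₗ` (`latticeVector` of the columns of `A`) span `ℝᵐ` over `ℝ`: every `x` is
`∑ⱼ cⱼ aⱼ` (with `c = A⁻¹ ·` the coordinates of `x`). [folklore] -/
theorem exists_sum_smul_latticeVector_eq (C : TorusCusp g m) {A : Matrix (Fin m) (Fin m) ℤ}
    (hA : A.det = 1 ∨ A.det = -1) (x : EuclideanSpace ℝ (Fin m)) :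
    ∃ c : Fin m → ℝ, ∑ j, c j • C.latticeVector (fun l => A l j) = x := by
  classical
  set Aℝ : Matrix (Fin m) (Fin m) ℝ := A.map (fun z : ℤ => (z : ℝ)) with hAℝ
  have hdet : IsUnit Aℝ.det := by
    rw [isUnit_iff_ne_zero, hAℝ, ← Int.cast_det]
    rcases hA with h | h <;> simp [h]
  refine ⟨Aℝ⁻¹.mulVec (C.basis.repr x), ?_⟩
  have key : ∀ c : Fin m → ℝ,
      ∑ j, c j • C.latticeVector (fun l => A l j) = ∑ l, (Aℝ.mulVec c) l • C.basis l := by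
    intro c
    simp only [TorusCusp.latticeVector, Finset.smul_sum, smul_smul, Matrix.mulVec, dotProduct,
      hAℝ, Matrix.map_apply, Finset.sum_smul]
    rw [Finset.sum_comm]
    refine Finset.sum_congr rfl fun l _ => Finset.sum_congr rfl fun j _ => ?_
    rw [mul_comm]
  rw [key, Matrix.mulVec_mulVec, Matrix.mul_nonsing_inv _ hdet, Matrix.one_mulVec]
  exact C.basis.sum_repr x

/-! ### The gluing relation is onto on both sides -/

/-- **Every point of the open cusp is glued to a point of the punctured filling piece**: for a
rank-`3` torus cusp `C`, a unimodular `A` and `t > 0`, the point `C (x, t)` is `fillingRel`-related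
to a point `((u₁, u₂), w)` of `T² × D̊²` at radius `‖w‖ = e^{-t}` (Anderson 2006, §2.1, (2.3): the
hyperbolic manifold is the complement of the core tori in `M_σ`).
[cite: Anderson2006, §2.1, (2.3)] -/
theorem exists_fillingRel_of_pos (C : TorusCusp g 3) {A : Matrix (Fin 3) (Fin 3) ℤ}
    (hA : A.det = 1 ∨ A.det = -1) (x : EuclideanSpace ℝ (Fin 3)) {t : ℝ} (ht : 0 < t) :
    ∃ b, C.fillingRel A (C (x, t)) b ∧ ‖b.2‖ = Real.exp (-t) := by
  obtain ⟨c, hc⟩ := C.exists_sum_smul_latticeVector_eq hA x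
  refine ⟨((circlePoint (2 * Real.pi * c 0), circlePoint (2 * Real.pi * c 1)),
      Real.exp (-t) • (circlePoint (2 * Real.pi * c 2) : EuclideanSpace ℝ (Fin 2))), ?_, ?_⟩
  · refine ⟨2 * Real.pi * c 0, 2 * Real.pi * c 1, 2 * Real.pi * c 2, Real.exp (-t),
      Real.exp_pos _, ?_, rfl, ?_⟩
    · rw [Real.exp_lt_one_iff]
      linarith
    · have h2π : (2 * Real.pi) ≠ 0 := by positivity
      simp only [mul_div_cancel_left₀ _ h2π, Real.log_exp, neg_neg]
      rw [← hc, Fin.sum_univ_three]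
  · rw [norm_smul, norm_eq_of_mem_sphere, mul_one, Real.norm_eq_abs, abs_of_pos (Real.exp_pos _)]

/-- **Every point of the punctured filling piece is glued to a point of the open cusp**: a point
`(u, w)` of `T² × D̊²` with `0 < ‖w‖ < 1` is `fillingRel`-related to the cusp point
`C (x, -log ‖w‖)` for a suitable `x` (write `u = (e^{iθ₁}, e^{iθ₂})`, `w = ‖w‖ e^{iθ₃}`).
[cite: Anderson2006, §2.1, (2.3)] -/
theorem exists_fillingRel_of_norm_pos (C : TorusCusp g 3) (A : Matrix (Fin 3) (Fin 3) ℤ)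
    (u : Metric.sphere (0 : EuclideanSpace ℝ (Fin (1 + 1))) 1 ×
      Metric.sphere (0 : EuclideanSpace ℝ (Fin (1 + 1))) 1)
    (w : EuclideanSpace ℝ (Fin 2)) (hw0 : w ≠ 0) (hw1 : ‖w‖ < 1) :
    ∃ x : EuclideanSpace ℝ (Fin 3), C.fillingRel A (C (x, -Real.log ‖w‖)) (u, w) := by
  obtain ⟨θ₁, hθ₁⟩ := circlePoint_surjective u.1
  obtain ⟨θ₂, hθ₂⟩ := circlePoint_surjective u.2
  have hw : ‖w‖ ≠ 0 := norm_ne_zero_iff.mpr hw0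
  have hu₃ : ‖w‖⁻¹ • w ∈ Metric.sphere (0 : EuclideanSpace ℝ (Fin 2)) 1 := by
    rw [mem_sphere_zero_iff_norm, norm_smul, norm_inv, norm_norm, inv_mul_cancel₀ hw]
  obtain ⟨θ₃, hθ₃⟩ := circlePoint_surjective ⟨‖w‖⁻¹ • w, hu₃⟩
  refine ⟨(θ₁ / (2 * Real.pi)) • C.latticeVector (fun l => A l 0) +
      (θ₂ / (2 * Real.pi)) • C.latticeVector (fun l => A l 1) +
      (θ₃ / (2 * Real.pi)) • C.latticeVector (fun l => A l 2),
    θ₁, θ₂, θ₃, ‖w‖, norm_pos_iff.mpr hw0, hw1, ?_, rfl⟩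
  rw [hθ₁, hθ₂, hθ₃, Subtype.coe_mk, smul_inv_smul₀ hw]

end TorusCusp

/-! ### The filling piece -/

/-- The part `T² × {‖w‖ ≤ ρ}`, `ρ < 1`, of the filling piece `T² × D̊²` is compact. [folklore] -/
theorem isCompact_fillingPiece_norm_le {ρ : ℝ} (hρ : ρ < 1) :
    IsCompact {b : fillingPiece | ‖b.val.2‖ ≤ ρ} := by
  rw [Subtype.isCompact_iff]
  have : Subtype.val '' {b : fillingPiece | ‖b.val.2‖ ≤ ρ} =
      univ ×ˢ Metric.closedBall (0 : EuclideanSpace ℝ (Fin 2)) ρ := by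
    ext q
    simp only [mem_image, mem_setOf_eq, mem_prod, mem_univ, true_and, Metric.mem_closedBall,
      dist_zero_right]
    constructor
    · rintro ⟨b, hb, rfl⟩
      exact hb
    · intro hq
      exact ⟨⟨q, (mem_fillingPiece_iff q).mpr (lt_of_le_of_lt hq hρ)⟩, hq, rfl⟩
  rw [this]
  exact isCompact_univ.prod (isCompact_closedBall _ _)

/-- The filling piece `T² × D̊²` is connected. [folklore] -/
theorem connectedSpace_fillingPiece : ConnectedSpace fillingPiece := by
  haveI : ConnectedSpace (Metric.sphere (0 : EuclideanSpace ℝ (Fin (1 + 1))) 1) := by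
    refine isConnected_iff_connectedSpace.mp (isConnected_sphere ?_ 0 zero_le_one)
    rw [← Module.finrank_eq_rank, finrank_euclideanSpace_fin]
    norm_num
  refine isConnected_iff_connectedSpace.mp ?_
  have hset : (fillingPiece : Set ((Metric.sphere (0 : EuclideanSpace ℝ (Fin (1 + 1))) 1 ×
      Metric.sphere (0 : EuclideanSpace ℝ (Fin (1 + 1))) 1) × EuclideanSpace ℝ (Fin 2))) =
      univ ×ˢ Metric.ball (0 : EuclideanSpace ℝ (Fin 2)) 1 := by
    ext q
    simp only [SetLike.mem_coe, mem_fillingPiece_iff, mem_prod, mem_univ, true_and, Metric.mem_ball,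
      dist_zero_right]
  rw [hset]
  exact isConnected_univ.prod ⟨⟨0, Metric.mem_ball_self one_pos⟩,
    (convex_ball (0 : EuclideanSpace ℝ (Fin 2)) 1).isPreconnected⟩

end General

/-! ### Dehn fillings are closed manifolds -/

section FourManifolds

variable {X : Type*} [TopologicalSpace X] [ChartedSpace (EuclideanSpace ℝ (Fin 4)) X]
  [IsManifold (𝓡 4) ∞ X]
  {g : PseudoRiemannianMetric (𝓡 4) ∞ (EuclideanSpace ℝ (Fin 4)) (TangentSpace (𝓡 4) : X → Type _)}
  {k : ℕ} {S : TorusCuspSystem g k 3} {A : Fin k → Matrix (Fin 3) (Fin 3) ℤ}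
  {P : Type*} [TopologicalSpace P] [ChartedSpace (EuclideanSpace ℝ (Fin 4)) P]

namespace IsDehnFilling

/-- **A Dehn filling of all the cusps is compact**: `P = jA (exterior) ∪ ⋃ᵢ jA (collarᵢ) ∪
⋃ᵢ jBᵢ (T² × {‖w‖ ≤ e⁻¹})`, three finite unions of continuous images of compact sets — a point
`C (x, t)` of the `i`-th open cusp lies in the collar if `t ≤ 1` and equals `jBᵢ` of a point at
radius `e^{-t} ≤ e^{-1}` otherwise; a point of the `i`-th piece at radius `r > e^{-1}` equals
`jA (C (x, -log r))` with `0 < -log r < 1` (Anderson 2006, §2.1, (2.2): the Dehn filled manifold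
`M_σ̄ = ⋃ (D² × T^{n-2}) ∪_φ N` of the compact `N`; Ratcliffe–Tschantz 2005, §2: "the closed
4-manifold `M̂` obtained by Dehn filling"). [cite: Anderson2006, §2.1, (2.2)] -/
theorem isCompact_univ (h : IsDehnFilling S A P) : IsCompact (univ : Set P) := by
  obtain ⟨hdet, jA, jB, hjA, -, hjB, hcover, -, hrel⟩ := h
  have hjAc : Continuous jA := hjA.isEmbedding.continuous
  have hjBc : ∀ i, Continuous (jB i) := fun i => (hjB i).1.isEmbedding.continuous
  have he1 : Real.exp (-1) < 1 := by
    rw [Real.exp_lt_one_iff]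
    norm_num
  set K : Set P := jA '' S.exterior ∪
    ((⋃ i, jA '' ((S.cusp i) '' (parallelepiped (S.cusp i).basis ×ˢ Icc (0 : ℝ) 1))) ∪
    ⋃ i, jB i '' {b : fillingPiece | ‖b.val.2‖ ≤ Real.exp (-1)}) with hK
  have hKc : IsCompact K := by
    refine (S.isCompact_exterior.image hjAc).union
      ((isCompact_iUnion fun i => ?_).union (isCompact_iUnion fun i => ?_))
    · exact (S.cusp i).isCompact_image_collarDomain.image hjAc
    · exact (isCompact_fillingPiece_norm_le he1).image (hjBc i)
  -- points of the open cusps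
  have cusp_case : ∀ (i : Fin k) (x : EuclideanSpace ℝ (Fin 3)) (t : ℝ), 0 < t →
      jA ((S.cusp i) (x, t)) ∈ K := by
    intro i x t ht
    rcases le_or_gt t 1 with ht1 | ht1
    · exact Or.inr (Or.inl (mem_iUnion.mpr
        ⟨i, mem_image_of_mem jA ((S.cusp i).mem_image_collarDomain x ht.le ht1)⟩))
    · obtain ⟨b, hb, hbn⟩ := (S.cusp i).exists_fillingRel_of_pos (hdet i) x ht
      have hbmem : b ∈ fillingPiece := by
        rw [mem_fillingPiece_iff, hbn, Real.exp_lt_one_iff]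
        linarith
      have heq : jA ((S.cusp i) (x, t)) = jB i ⟨b, hbmem⟩ := (hrel i _ ⟨b, hbmem⟩).mpr hb
      refine Or.inr (Or.inr (mem_iUnion.mpr ⟨i, ⟨⟨b, hbmem⟩, ?_, heq.symm⟩⟩))
      show ‖b.2‖ ≤ Real.exp (-1)
      rw [hbn, Real.exp_le_exp]
      linarith
  refine hKc.of_isClosed_subset isClosed_univ fun p _ => ?_
  have hp : p ∈ range jA ∪ ⋃ i, range (jB i) := by
    rw [hcover]
    exact mem_univ p
  rcases hp with ⟨a, rfl⟩ | hp
  · by_cases ha : a ∈ S.exterior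
    · exact Or.inl (mem_image_of_mem jA ha)
    · have hex : a ∈ ⋃ i, (S.cusp i).openNbhd := by
        by_contra h'
        exact ha h'
      obtain ⟨i, hi⟩ := mem_iUnion.mp hex
      obtain ⟨⟨x, t⟩, ht, rfl⟩ := hi
      exact cusp_case i x t ht
  · obtain ⟨i, b, rfl⟩ := mem_iUnion.mp hp
    rcases le_or_gt ‖b.val.2‖ (Real.exp (-1)) with hb | hb
    · exact Or.inr (Or.inr (mem_iUnion.mpr ⟨i, mem_image_of_mem _ hb⟩))
    · have hb1 : ‖b.val.2‖ < 1 := (mem_fillingPiece_iff _).mp b.2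
      have hb0 : b.val.2 ≠ 0 := by
        intro h0
        rw [h0, norm_zero] at hb
        exact lt_irrefl _ (hb.trans (Real.exp_pos _))
      obtain ⟨x, hx⟩ :=
        (S.cusp i).exists_fillingRel_of_norm_pos (A i) b.val.1 b.val.2 hb0 hb1
      have heq : jA ((S.cusp i) (x, -Real.log ‖b.val.2‖)) = jB i b :=
        (hrel i _ b).mpr (by simpa only [Prod.mk.eta] using hx)
      rw [← heq]
      exact cusp_case i x _ (neg_pos.mpr (Real.log_neg (norm_pos_iff.mpr hb0) hb1))

/-- **A Dehn filling of a cusped hyperbolic four-manifold is a closed manifold**: `P` is compact.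
[cite: RatcliffeTschantz2005, §2, p. 4] -/
theorem compactSpace (h : IsDehnFilling S A P) : CompactSpace P :=
  ⟨h.isCompact_univ⟩

/-- Every filling piece meets the image of `X`: `jA (C (x, t)) ∈ range (jB i)` for `t > 0`.
[folklore] -/
theorem exists_inter_nonempty (h : IsDehnFilling S A P) :
    ∃ (jA : X → P) (jB : Fin k → fillingPiece → P), Continuous jA ∧ (∀ i, Continuous (jB i)) ∧
      range jA ∪ (⋃ i, range (jB i)) = univ ∧ ∀ i, (range jA ∩ range (jB i)).Nonempty := by
  obtain ⟨hdet, jA, jB, hjA, -, hjB, hcover, -, hrel⟩ := h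
  refine ⟨jA, jB, hjA.isEmbedding.continuous, fun i => (hjB i).1.isEmbedding.continuous, hcover,
    fun i => ?_⟩
  obtain ⟨b, hb, hbn⟩ := (S.cusp i).exists_fillingRel_of_pos (hdet i) 0 one_pos
  have hbmem : b ∈ fillingPiece := by
    rw [mem_fillingPiece_iff, hbn, Real.exp_lt_one_iff]
    norm_num
  exact ⟨_, ⟨_, rfl⟩, ⟨⟨b, hbmem⟩, ((hrel i _ ⟨b, hbmem⟩).mpr hb).symm⟩⟩

/-- **A Dehn filling of a connected cusped hyperbolic four-manifold is connected**: `P` is the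
union of the connected sets `range jA ∪ range (jB i)` (each piece `T² × D̊²` is connected and
meets `jA (X)` along the glued cusp), all containing `range jA`. [folklore] -/
theorem connectedSpace [ConnectedSpace X] (h : IsDehnFilling S A P) : ConnectedSpace P := by
  obtain ⟨jA, jB, hjAc, hjBc, hcover, hmeet⟩ := h.exists_inter_nonempty
  haveI : ConnectedSpace fillingPiece := connectedSpace_fillingPiece
  have hA : IsConnected (range jA) := isConnected_range hjAc
  have hB : ∀ i, IsConnected (range (jB i)) := fun i => isConnected_range (hjBc i)
  have huniv : IsPreconnected (univ : Set P) := by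
    have hU : (univ : Set P) =
        ⋃ o : Option (Fin k), o.elim (range jA) (fun i => range jA ∪ range (jB i)) := by
      rw [← hcover]
      ext p
      simp only [mem_union, mem_iUnion]
      constructor
      · rintro (hp | ⟨i, hp⟩)
        exacts [⟨none, hp⟩, ⟨some i, Or.inr hp⟩]
      · rintro ⟨_ | i, hp⟩
        exacts [Or.inl hp, hp.elim Or.inl fun h => Or.inr ⟨i, h⟩]
    rw [hU]
    obtain ⟨p₀, hp₀⟩ := hA.nonempty
    refine isPreconnected_iUnion ⟨p₀, mem_iInter.mpr ?_⟩ ?_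
    · rintro (_ | i)
      exacts [hp₀, Or.inl hp₀]
    · rintro (_ | i)
      · exact hA.isPreconnected
      · obtain ⟨q, hq₁, hq₂⟩ := hmeet i
        exact hA.isPreconnected.union q hq₁ hq₂ (hB i).isPreconnected
  haveI : PreconnectedSpace P := ⟨huniv⟩
  exact ⟨⟨jA (Classical.arbitrary X)⟩⟩

end IsDehnFilling

/-! ### Consequences of the `2π` theorem -/

/-- **Fake 4-spheres are exceptional fillings** (the consequence of the `2π` theorem used by
route `HyperbolicTorusFillings`; Ratcliffe–Tschantz 2005, §2, p. 5 and §5, p. 9: "If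
`length(mᵢ') ≥ 2π` for each `i`, then `M̂` admits a Riemannian metric of nonpositive curvature.
This implies that the universal cover of `M̂` is diffeomorphic to `ℝ⁴` by Cartan's theorem").
Modulo the named facts `gromovThurston_twoPi_four` (Anderson 2006, §2.1, (2.4)) and
`Lee2018_not_simplyConnected_of_nonpos_curvature` (Lee 2018, Cor. 12.11): if `X` is a connected
(Hausdorff, second countable) smooth `4`-manifold with a complete finite-volume hyperbolic metric
`g`, `S` a complete system of rank-`3` torus cusps and `P` a Dehn filling of all the cusps along
`A` whose slopes all have flat length `≥ 2π`, then the closed manifold `P` is NOT simply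
connected. Proof: `P` is compact (`IsDehnFilling.compactSpace`), carries a nonpositively curved
metric by the first fact, hence is not simply connected by the second.
[cite: RatcliffeTschantz2005, §5, p. 9] -/
theorem IsDehnFilling.not_simplyConnectedSpace_of_two_pi_le
    (h2π : gromovThurston_twoPi_four) (hCH : Lee2018_not_simplyConnected_of_nonpos_curvature)
    {X : Type} [TopologicalSpace X] [T3Space X] [SecondCountableTopology X]
    [ChartedSpace (EuclideanSpace ℝ (Fin 4)) X] [IsManifold (𝓡 4) ∞ X] [ConnectedSpace X]
    {g : PseudoRiemannianMetric (𝓡 4) ∞ (EuclideanSpace ℝ (Fin 4))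
      (TangentSpace (𝓡 4) : X → Type _)}
    {k : ℕ} {S : TorusCuspSystem g k 3} {A : Fin k → Matrix (Fin 3) (Fin 3) ℤ}
    {P : Type} [TopologicalSpace P] [T2Space P] [SecondCountableTopology P]
    [ChartedSpace (EuclideanSpace ℝ (Fin 4)) P] [IsManifold (𝓡 4) ∞ P]
    (hg : g.IsFiniteVolumeHyperbolic) (hP : IsDehnFilling S A P)
    (hlen : ∀ i, 2 * Real.pi ≤ (S.cusp i).slopeLength fun l => A i l 2) :
    ¬ SimplyConnectedSpace P := by
  obtain ⟨g', cov, hg', hcov, hK⟩ := h2π X g k S A P hg hP hlen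
  haveI : CompactSpace P := hP.compactSpace
  exact hCH 3 P g' cov hg' hcov hK

/-- **Long fillings are covered by `ℝ⁴`** (the asphericity clause; Ratcliffe–Tschantz 2005, §5,
p. 9: "the universal cover of `M̂` is diffeomorphic to `ℝ⁴` by Cartan's theorem; in which case
`M̂` is aspherical, and so `M̂` is a `K(π, 1)`"). Modulo the named facts `gromovThurston_twoPi_four`
and `Lee2018_cartanHadamard_compact` (Lee 2018, Thm. 12.8): under the hypotheses of
`not_simplyConnectedSpace_of_two_pi_le`, there is a covering map `ℝ⁴ → P` which is a surjective
local diffeomorphism. [cite: RatcliffeTschantz2005, §5, p. 9] -/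
theorem IsDehnFilling.exists_covering_of_two_pi_le
    (h2π : gromovThurston_twoPi_four) (hCH : Lee2018_cartanHadamard_compact)
    {X : Type} [TopologicalSpace X] [T3Space X] [SecondCountableTopology X]
    [ChartedSpace (EuclideanSpace ℝ (Fin 4)) X] [IsManifold (𝓡 4) ∞ X] [ConnectedSpace X]
    {g : PseudoRiemannianMetric (𝓡 4) ∞ (EuclideanSpace ℝ (Fin 4))
      (TangentSpace (𝓡 4) : X → Type _)}
    {k : ℕ} {S : TorusCuspSystem g k 3} {A : Fin k → Matrix (Fin 3) (Fin 3) ℤ}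
    {P : Type} [TopologicalSpace P] [T2Space P] [SecondCountableTopology P]
    [ChartedSpace (EuclideanSpace ℝ (Fin 4)) P] [IsManifold (𝓡 4) ∞ P]
    (hg : g.IsFiniteVolumeHyperbolic) (hP : IsDehnFilling S A P)
    (hlen : ∀ i, 2 * Real.pi ≤ (S.cusp i).slopeLength fun l => A i l 2) :
    ∃ proj : EuclideanSpace ℝ (Fin 4) → P, IsCoveringMap proj ∧ Function.Surjective proj ∧
      IsLocalDiffeomorph (𝓡 4) (𝓡 4) ∞ proj := by
  obtain ⟨g', cov, hg', hcov, hK⟩ := h2π X g k S A P hg hP hlen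
  haveI : CompactSpace P := hP.compactSpace
  haveI : ConnectedSpace P := hP.connectedSpace
  exact hCH 4 P g' cov hg' hcov hK

/-- **The census principle** (Ratcliffe–Tschantz 2005, §2, p. 5: `M̂` is aspherical "when
`length(mᵢ') ≥ 2π` for each `i` … There are only finitely many homology classes of oriented
circles of length less than `2π` on the flat 3-torus `T³ᵢ` for each `i`"). Modulo the two named
facts of `not_simplyConnectedSpace_of_two_pi_le`: a SIMPLY CONNECTED Dehn filling of a connected
complete finite-volume hyperbolic `4`-manifold with `3`-torus cusps has, on some cusp torus, a
slope of flat length `< 2π` — and per cusp only finitely many filling coefficients are that short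
(`TorusCusp.finite_setOf_slopeLength_lt_two_pi`). [cite: RatcliffeTschantz2005, §2, p. 5] -/
theorem IsDehnFilling.exists_slopeLength_lt_two_pi_of_simplyConnected
    (h2π : gromovThurston_twoPi_four) (hCH : Lee2018_not_simplyConnected_of_nonpos_curvature)
    {X : Type} [TopologicalSpace X] [T3Space X] [SecondCountableTopology X]
    [ChartedSpace (EuclideanSpace ℝ (Fin 4)) X] [IsManifold (𝓡 4) ∞ X] [ConnectedSpace X]
    {g : PseudoRiemannianMetric (𝓡 4) ∞ (EuclideanSpace ℝ (Fin 4))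
      (TangentSpace (𝓡 4) : X → Type _)}
    {k : ℕ} {S : TorusCuspSystem g k 3} {A : Fin k → Matrix (Fin 3) (Fin 3) ℤ}
    {P : Type} [TopologicalSpace P] [T2Space P] [SecondCountableTopology P]
    [ChartedSpace (EuclideanSpace ℝ (Fin 4)) P] [IsManifold (𝓡 4) ∞ P] [SimplyConnectedSpace P]
    (hg : g.IsFiniteVolumeHyperbolic) (hP : IsDehnFilling S A P) :
    ∃ i, (S.cusp i).slopeLength (fun l => A i l 2) < 2 * Real.pi := by
  by_contra hne
  refine hP.not_simplyConnectedSpace_of_two_pi_le h2π hCH hg (fun i => ?_) ‹SimplyConnectedSpace P›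
  exact not_lt.mp fun hlt => hne ⟨i, hlt⟩

end FourManifolds

end Literature.Geometry.Riemannian

end
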